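import Mathlib
/-! # Stub `stub_letterBelow` — crux `TwoProducts` (stmt-ValiantsHypothesis-5906), line `corner-log-linearization`
   LETTER BELOW (structural brick of the support-only normal form).

   Setting: bivariate polynomials `u_i` (`i < k`) and `v_j` (`j < m`); in the power series ring put
   `U = ∏ ↑u_i`, `Q = ∏ ↑v_j` and `G = U * Q⁻¹` (the `MvPowerSeries` inverse over the field `ℂ`).
   Claim: every NONZERO support point `e` of `G` dominates coordinatewise a nonzero letter, i.e. a
   nonzero exponent `a ≤ e` lying in the support of some `u_i` or some `v_j`.

   Proof: call a power series `φ` *letter-bounded* (by a finite set of exponents `L`) when every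
   nonzero support point of `φ` dominates a nonzero element of `L`.  This class contains `1` and the
   coercion of every polynomial whose support lies in `L` (a support point is its own letter), and it
   is closed under products (antidiagonal expansion `MvPowerSeries.coeff_mul`: a nonzero term
   `φ_i ψ_j` with `i + j = e ≠ 0` has `i ≠ 0` or `j ≠ 0`) and under the field inverse
   (`MvPowerSeries.coeff_inv`: for `e ≠ 0` the coefficient `(φ⁻¹)_e` is `-φ₀⁻¹ ∑ φ_i (φ⁻¹)_j` over
   `i + j = e`, `j < e`, so a nonzero term has `i ≠ 0` a support point of `φ`).  Hence `G` is
   letter-bounded by the union of all supports.  The hypothesis `v_j(0) = 1` of the registered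
   signature is not needed (Mathlib's inverse is total) and is kept only to match the registration.
   The property is spelled out inline in every lemma (no auxiliary definition). [folklore] -/
set_option linter.dupNamespace false -- single-conjunct summit: `ValiantsHypothesis.ValiantsHypothesis`
namespace Summit.ValiantsHypothesis.ValiantsHypothesis.Theorems.TwoProducts.LetterBelow
open scoped BigOperators

/-- PRODUCTS.  If every nonzero support point of `φ` and of `ψ` dominates a nonzero element of `L`,
then so does every nonzero support point of `φ * ψ` (antidiagonal expansion). [folklore] -/
theorem letterBelow_mul {σ R : Type*} [CommSemiring R] (L : Finset (σ →₀ ℕ))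
    {φ ψ : MvPowerSeries σ R}
    (hφ : ∀ e : σ →₀ ℕ, e ≠ 0 → MvPowerSeries.coeff e φ ≠ 0 → ∃ a ∈ L, a ≠ 0 ∧ a ≤ e)
    (hψ : ∀ e : σ →₀ ℕ, e ≠ 0 → MvPowerSeries.coeff e ψ ≠ 0 → ∃ a ∈ L, a ≠ 0 ∧ a ≤ e) :
    ∀ e : σ →₀ ℕ, e ≠ 0 → MvPowerSeries.coeff e (φ * ψ) ≠ 0 → ∃ a ∈ L, a ≠ 0 ∧ a ≤ e := by
  classical
  intro e he h
  rw [MvPowerSeries.coeff_mul] at h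
  obtain ⟨⟨i, j⟩, hij, hne⟩ := Finset.exists_ne_zero_of_sum_ne_zero h
  have hij' : i + j = e := by simpa using hij
  by_cases hi : i = 0
  · subst hi
    rw [zero_add] at hij'
    subst hij'
    exact hψ j he (right_ne_zero_of_mul hne)
  · obtain ⟨a, haL, ha0, hale⟩ := hφ i hi (left_ne_zero_of_mul hne)
    exact ⟨a, haL, ha0, hale.trans (hij' ▸ le_self_add)⟩

/-- INVERSES (over a field).  If every nonzero support point of `φ` dominates a nonzero element of
`L`, then so does every nonzero support point of the (total) inverse `φ⁻¹`: by
`MvPowerSeries.coeff_inv`, for `e ≠ 0` a nonzero `(φ⁻¹)_e` forces a nonzero term `φ_i (φ⁻¹)_j`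
with `i + j = e` and `j < e`, whence `i ≠ 0`. [folklore] -/
theorem letterBelow_inv {σ K : Type*} [Field K] (L : Finset (σ →₀ ℕ)) {φ : MvPowerSeries σ K}
    (hφ : ∀ e : σ →₀ ℕ, e ≠ 0 → MvPowerSeries.coeff e φ ≠ 0 → ∃ a ∈ L, a ≠ 0 ∧ a ≤ e) :
    ∀ e : σ →₀ ℕ, e ≠ 0 → MvPowerSeries.coeff e φ⁻¹ ≠ 0 → ∃ a ∈ L, a ≠ 0 ∧ a ≤ e := by
  classical
  intro e he h
  rw [MvPowerSeries.coeff_inv, if_neg he] at h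
  obtain ⟨⟨i, j⟩, hij, hne⟩ := Finset.exists_ne_zero_of_sum_ne_zero (right_ne_zero_of_mul h)
  have hij' : i + j = e := by simpa using hij
  have hj : j < e := by
    by_contra hj
    exact hne (if_neg hj)
  rw [if_pos hj] at hne
  have hi : i ≠ 0 := by
    rintro rfl
    rw [zero_add] at hij'
    exact hj.ne hij'
  obtain ⟨a, haL, ha0, hale⟩ := hφ i hi (left_ne_zero_of_mul hne)
  exact ⟨a, haL, ha0, hale.trans (hij' ▸ le_self_add)⟩

/-- ONE.  The series `1` has no nonzero support point, so the letter-below property holds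
vacuously. [folklore] -/
theorem letterBelow_one {σ R : Type*} [CommSemiring R] (L : Finset (σ →₀ ℕ)) :
    ∀ e : σ →₀ ℕ, e ≠ 0 → MvPowerSeries.coeff e (1 : MvPowerSeries σ R) ≠ 0 →
      ∃ a ∈ L, a ≠ 0 ∧ a ≤ e := by
  classical
  intro e he h
  rw [MvPowerSeries.coeff_one, if_neg he] at h
  exact absurd rfl h

/-- FINITE PRODUCTS.  If every factor `f i`, `i ∈ s`, has the letter-below property with respect
to `L`, then so does `∏ i ∈ s, f i` (induction on `s`). [folklore] -/
theorem letterBelow_prod {σ R ι : Type*} [CommSemiring R] (L : Finset (σ →₀ ℕ)) (s : Finset ι)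
    (f : ι → MvPowerSeries σ R)
    (hf : ∀ i ∈ s, ∀ e : σ →₀ ℕ, e ≠ 0 → MvPowerSeries.coeff e (f i) ≠ 0 →
      ∃ a ∈ L, a ≠ 0 ∧ a ≤ e) :
    ∀ e : σ →₀ ℕ, e ≠ 0 → MvPowerSeries.coeff e (∏ i ∈ s, f i) ≠ 0 →
      ∃ a ∈ L, a ≠ 0 ∧ a ≤ e := by
  classical
  induction s using Finset.induction_on with
  | empty =>
    rw [Finset.prod_empty]
    exact letterBelow_one L
  | insert i s his ih =>
    rw [Finset.prod_insert his]
    exact letterBelow_mul L (hf i (Finset.mem_insert_self i s))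
      (ih fun i' hi' => hf i' (Finset.mem_insert_of_mem hi'))

/-- POLYNOMIALS.  A nonzero support point of (the power series of) a polynomial whose support lies
in `L` is its own letter. [folklore] -/
theorem letterBelow_coe {σ R : Type*} [CommSemiring R] (L : Finset (σ →₀ ℕ))
    (p : MvPolynomial σ R) (hp : p.support ⊆ L) :
    ∀ e : σ →₀ ℕ, e ≠ 0 → MvPowerSeries.coeff e (p : MvPowerSeries σ R) ≠ 0 →
      ∃ a ∈ L, a ≠ 0 ∧ a ≤ e := by
  intro e he h
  rw [MvPolynomial.coeff_coe] at h
  exact ⟨e, hp (MvPolynomial.mem_support_iff.mpr h), he, le_rfl⟩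

/-- **Letter below** (structural stub `stub_letterBelow`, registered signature).  For bivariate
polynomials `u_i`, `v_j` (the `v_j` of constant term `1`), every nonzero support point `e` of the
power series `(∏ ↑u_i) * (∏ ↑v_j)⁻¹` dominates coordinatewise a nonzero exponent in the support of
some `u_i` or some `v_j`. [folklore] -/
theorem stub_letterBelow : ∀ (k m : ℕ) (u : Fin k → MvPolynomial (Fin 2) ℂ)
    (v : Fin m → MvPolynomial (Fin 2) ℂ), (∀ j, MvPolynomial.coeff 0 (v j) = 1) →
    ∀ e : Fin 2 →₀ ℕ, e ≠ 0 →
      MvPowerSeries.coeff e ((∏ i, ((u i : MvPolynomial (Fin 2) ℂ) : MvPowerSeries (Fin 2) ℂ)) *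
          (∏ j, ((v j : MvPolynomial (Fin 2) ℂ) : MvPowerSeries (Fin 2) ℂ))⁻¹) ≠ 0 →
      ∃ a ∈ ((Finset.univ.biUnion fun i => (u i).support) ∪ (Finset.univ.biUnion fun j => (v j).support)),
        a ≠ 0 ∧ a ≤ e := by
  intro k m u v _hv
  refine letterBelow_mul _ (letterBelow_prod _ _ _ fun i _ => letterBelow_coe _ (u i) ?_)
    (letterBelow_inv _ (letterBelow_prod _ _ _ fun j _ => letterBelow_coe _ (v j) ?_))
  · exact fun a ha =>
      Finset.mem_union_left _ (Finset.mem_biUnion.mpr ⟨i, Finset.mem_univ i, ha⟩)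
  · exact fun a ha =>
      Finset.mem_union_right _ (Finset.mem_biUnion.mpr ⟨j, Finset.mem_univ j, ha⟩)

end Summit.ValiantsHypothesis.ValiantsHypothesis.Theorems.TwoProducts.LetterBelow
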